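import Mathlib
import HarnessLib
import Summits.HubbardSuperconductivity.HubbardSuperconductivity.Theorems.KLProgrammeKLRegimeSplitTwoLegReadingSlopes
import Summits.HubbardSuperconductivity.HubbardSuperconductivity.Theorems.KLProgrammeKLRegimeEngineSelfEnergySymmetric

/-!
# Route `KLProgramme` — ENGINE child 19855 `KLRegimeEngineV12`, two-leg stubs: the (E3e) supplier KEYED BY `FrameOK` IN THE KL REGIME —
# `TwoLegSlopes` for every admissible frame from (E3d) + ONE gradient bound, in the binder shape of `stub_twoLeg_scale0` / `stub_twoLeg_step`

Cell `gate-hubbard-kl`, seat p1b (g6); continues `…TwoLegReadingSlopes` (p480798).  There the supplier `twoLegSlopes_of_fieldStrength_of_gradient`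
takes a frame of `C²` size `A` with `2A < Dt_min` and the shell inside a level window `[a, b]` carrying `B : BandBounds a b`.  Here those
hypotheses are DISCHARGED for every admissible frame of the regime, exactly as the lineage keys its curve lemmas (`contDiff_klLocalPart_of_frameOK`,
`fermiPointLp_C4_of_frameOK`): `FrameOK R U (nScales β) μ K` with `klBetaMin ≤ β ≤ e^{c/U²}` gives the `C²` size
`A = 2Gfr₀|U| + 2Gfr₁U² + Gfr₂·c/log 4` (`norm_iteratedFDeriv_frameShift_le_of_frameOK_regime`), `frame_thresholds` makes `4A ≤ min(Dt_min, 1/5)`, and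
with the band window `[−1.2, −0.05]` (`bandBounds`) the scale-`n` shell `|e_K| ≤ Λ_n ≤ 1/32` of every `μ ∈ klWindowC = [−1.05, −0.15]` fits:
`μ ± (A + Λ_n) ∈ [−1.2, −0.05]`.  (E0) is p3's `selfEnergySymmetric_all`.  Result:

* `twoLegSlopes_of_frameOK_regime`: for every `R` (`Gfr ≥ 0`) there are `c₃, U₀, D > 0` (explicit in `R`; `D = Dt_min/2` of `bandBounds (−1.2) (−0.05)`)
  such that for `0 < c ≤ c₃`, `0 < U ≤ U₀`, `klBetaMin ≤ β ≤ e^{c/U²}`, `μ ∈ klWindowC`, every admissible `K`, every volume `(L, M)` and scale `n`: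
  (E3d) on the shell + `‖D(evalM S_n)‖ ≤ b` with `0 ≤ b ≤ cz·|U|·D` ⇒ `TwoLegSlopes L M R β U μ K n`.

So inside the engine skeleton the (E3d/e) conjunct of `TwoLegStepV12 … n` costs the stub prover exactly two engine numbers: the field strength and
`b = coeffNorm 1 S_n` (p458816) against `cz|U|·D`.  Everything is PROVED; no definitions; nothing about the model is asserted.
References: BGM 2006 §2.4 Lemma 2.1 [cite: BenfattoGiulianiMastropietro2006].
-/

noncomputable section

namespace Summit.HubbardSuperconductivity.HubbardSuperconductivity.Theorems.KLRegimeSplit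

set_option linter.dupNamespace false -- summit = problem name (single-conjunct summit), D-0017

open Real Set
open Literature.MathematicalPhysics.QuantumLattice Literature.MathematicalPhysics.QuantumLattice.BandSectorCounting
open Literature.Probability.LatticeModels
open Summit.HubbardSuperconductivity.HubbardSuperconductivity.Theorems.DispersionFlow
open Summit.HubbardSuperconductivity.HubbardSuperconductivity.Theorems.PerturbedFermiCurve
open Summit.HubbardSuperconductivity.HubbardSuperconductivity.Theorems.KLProgrammeLegKernels

/-- `Λ_n ≤ e₀ = 1/32`: the scales decrease. -/
theorem klScale_klE0_le_klE0 (n : ℕ) : klScale klE0 n ≤ klE0 := by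
  unfold klScale
  have h1 : ((4 : ℝ) ^ n)⁻¹ ≤ 1 := inv_le_one_of_one_le₀ (one_le_pow₀ (by norm_num))
  have h0 : 0 ≤ klE0 := by unfold klE0; norm_num
  calc klE0 * ((4 : ℝ) ^ n)⁻¹ ≤ klE0 * 1 := mul_le_mul_of_nonneg_left h1 h0
    _ = klE0 := mul_one _

/-- Arithmetic of the windows: for `μ ∈ klWindowC = [−1.05, −0.15]`, `A ≤ 1/20` and `Λ ≤ 1/32`, the shell window `[μ − A − Λ, μ + A + Λ]` lies in
`[−1.2, −0.05]`. -/
theorem klWindowC_shell_margin {μ : ℝ} (hμ : μ ∈ klWindowC) {A Λ : ℝ} (hA : A ≤ 1 / 20) (hΛ : Λ ≤ klE0) :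
    (-1.2 : ℝ) ≤ μ - A - Λ ∧ μ + A + Λ ≤ -0.05 := by
  obtain ⟨h1, h2⟩ := hμ
  unfold klE0 at hΛ
  constructor <;> linarith

/-- **(E3d/e) `TwoLegSlopes` FOR EVERY ADMISSIBLE FRAME IN THE KL REGIME, from the field strength and ONE gradient bound.**  For every
renormalisation package `R` (`Gfr ≥ 0`) there are `c₃, U₀, D > 0` such that: for `0 < c ≤ c₃`, `0 < U ≤ U₀`, `klBetaMin ≤ β ≤ e^{c/U²}`,
`μ ∈ klWindowC`, every frame `K` with `FrameOK R U (nScales β) μ K`, all volumes `(L, M)` and every scale `n`: if the field strength of the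
scale-`n` action satisfies `|z_n(k⃗) − 1| ≤ cz|U|` on the shell `S_n` ((E3d), engine) and the two-leg interpolant
`S_n = symInterp L (klLocSelfEnergyRe … n)` has `‖D(evalM S_n)‖ ≤ b` on `Momentum` with `0 ≤ b ≤ cz·|U|·D` (engine; `b = coeffNorm 1 S_n`), then
`TwoLegSlopes L M R β U μ K n`.  (`D = Dt_min/2` of `bandBounds (−1.2) (−0.05)`; (E0) by `selfEnergySymmetric_all`.)
[cite: BenfattoGiulianiMastropietro2006, §2.4 Lemma 2.1] -/
theorem twoLegSlopes_of_frameOK_regime (R : RenConsts) (hR : ∀ j, 0 ≤ R.Gfr j) :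
    ∃ c₃ : ℝ, 0 < c₃ ∧ ∃ U₀ : ℝ, 0 < U₀ ∧ ∃ D : ℝ, 0 < D ∧
      ∀ c : ℝ, 0 < c → c ≤ c₃ → ∀ U : ℝ, 0 < U → U ≤ U₀ → ∀ β : ℝ, klBetaMin ≤ β → β ≤ Real.exp (c / U ^ 2) →
      ∀ μ ∈ klWindowC, ∀ K : TrigPolyC4v, FrameOK R U (nScales β) μ K →
        ∀ (L M : ℕ) [NeZero L] [NeZero M] (n : ℕ) (bS : ℝ), 0 ≤ bS →
          (∀ q : Momentum, ‖fderiv ℝ (evalM (symInterp L (klLocSelfEnergyRe L M β U μ K n))) q‖ ≤ bS) →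
          bS ≤ R.cz * |U| * D →
          (∀ k ∈ klShell L μ K n, |klFieldStrength L M β U μ K n k - 1| ≤ R.cz * |U|) →
            TwoLegSlopes L M R β U μ K n := by
  have ha : (-4 : ℝ) < -1.2 := by norm_num
  have hab : (-1.2 : ℝ) ≤ -0.05 := by norm_num
  have hb : (-0.05 : ℝ) < 0 := by norm_num
  set B := bandBounds ha hab hb with hBdef
  have hDt := B.Dtmin_pos
  set κ : ℝ := min B.Dtmin (1 / 5) with hκdef
  have hκ : 0 < κ := lt_min hDt (by norm_num)
  obtain ⟨c₃, hc₃, U₀, hU₀, hthr⟩ := frame_thresholds hR hκ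
  refine ⟨c₃, hc₃, U₀, hU₀, B.Dtmin / 2, by positivity, ?_⟩
  intro c hc hcle U hU hUle β hβmin hβc μ hμ K hK L M _ _ n bS hbS hgrad hb hz
  have hAf : ∀ p : Momentum, ∀ j ≤ 2, ‖iteratedFDeriv ℝ j (frameShift K) p‖ ≤
      2 * R.Gfr 0 * |U| + 2 * R.Gfr 1 * U ^ 2 + R.Gfr 2 * (c / Real.log 4) := fun p j hj =>
    norm_iteratedFDeriv_frameShift_le_of_frameOK_regime hR hc.le hβmin hβc hK p hj
  set A := 2 * R.Gfr 0 * |U| + 2 * R.Gfr 1 * U ^ 2 + R.Gfr 2 * (c / Real.log 4) with hAdef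
  have h4A : 4 * A ≤ κ := hthr c U hc.le hcle hU hUle
  have hA0 : 0 ≤ A := le_trans (norm_nonneg _) (hAf 0 0 (by norm_num))
  have hκDt : κ ≤ B.Dtmin := min_le_left _ _
  have hκ5 : κ ≤ 1 / 5 := min_le_right _ _
  have hADt : 2 * A < B.Dtmin := by linarith
  have hA20 : A ≤ 1 / 20 := by linarith
  obtain ⟨hloΛ, hhiΛ⟩ := klWindowC_shell_margin hμ hA20 (klScale_klE0_le_klE0 n)
  -- `b ≤ cz|U|·(Dt_min/2) ≤ cz|U|·(Dt_min − 2A)` (using `0 ≤ b` to get `0 ≤ cz|U|`)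
  have hczU : 0 ≤ R.cz * |U| := by
    by_contra hneg
    have hneg' : R.cz * |U| < 0 := lt_of_not_ge hneg
    have : R.cz * |U| * (B.Dtmin / 2) < 0 := mul_neg_of_neg_of_pos hneg' (by positivity)
    linarith
  have hb' : bS ≤ R.cz * |U| * (B.Dtmin - 2 * A) :=
    hb.trans (mul_le_mul_of_nonneg_left (by linarith) hczU)
  exact twoLegSlopes_of_fieldStrength_of_gradient B hAf hADt hloΛ hhiΛ (selfEnergySymmetric_all L M β U μ K n) hz hbS hgrad hb'

end Summit.HubbardSuperconductivity.HubbardSuperconductivity.Theorems.KLRegimeSplit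

end
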